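import Literature.Computability.QuantumComplexity.CliffordTInverseCode
import Literature.Computability.Complexity.BrickAlgebra
import Literature.Computability.Complexity.PlumbingBricks
import Literature.Computability.Complexity.StringEquality
import HarnessLib

/-!
# The inverse-code transformation is polynomial time

Sequel of `CliffordTInverseCode.lean` (`encode_inv`: the description of the inverse of an
oracle-free Clifford+T circuit is `encList (invCodeItems items)` for the list `items` of its gate
codes, `invCodeItems` = reverse and repeat each code by `invRepsOfCode`). Here the string map
**`invCodeFn : encList items ↦ encList (invCodeItems items)`** is assembled from the
polynomial-time bricks of `Complexity/` (pair projections and fan-out `BrickAlgebra`, prefix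
plumbing `PlumbingBricks`, the equality test `StringEquality.eqPairFn`, branching `iteFn`,
bounded iteration `IterateFPGrowth`) and proved to be in `FP` (`invCodeFn_mem_FP`) with the value
`invCodeFn_encList`. One round (`roundF`) of the iteration pops the first code `a` of the
remaining list and pushes `invRepsOfCode a` copies of it onto the accumulator; the repetition
count is decided by comparing the symbol numeral behind the tag bit with `bin 1`, `bin 2`
(`isS`, `isT`); the popped code is truncated to the length of the input (harmless on real
runs) so that the round has linear growth on *every* input, as the iteration lemma demands.

This is the last string-level ingredient of the uniformity of families running the inverses of
the circuits of a given uniform family (Bernstein–Vazirani 1997, §8: classical computation and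
uncomputation inside quantum machines).

## References

* S. Arora, B. Barak, *Computational Complexity: A Modern Approach*, CUP 2009, §1.3, Remark 6.7.
* E. Bernstein, U. Vazirani, *Quantum complexity theory*, SIAM J. Comput. 26 (1997), §8.
-/

noncomputable section

namespace Literature.Computability.QuantumComplexity

namespace InvCode

open _root_.Computability Complexity Complexity.Brick Complexity.Plumb Polynomial

/-! ### The round -/

/-- The popped code: the first item of the remaining list (field `1`), truncated to the length
of the input (field `0`). [folklore] -/
def itemF : List Bool → List Bool := takeFn ∘ fanoutFn (nthF 0) (fstF ∘ nthF 1)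

/-- The symbol numeral of the popped code (`symbolOfCode`: first component behind the tag bit).
[folklore] -/
def symF : List Bool → List Bool := fstF ∘ dropFn ∘ fanoutFn (fun _ => [true]) itemF

/-- Test: the popped code is an `S` gate (symbol numeral `bin 1 = [1]`). [folklore] -/
def isS : List Bool → List Bool := eqPairFn ∘ fanoutFn symF fun _ => [true]

/-- Test: the popped code is a `T` gate (symbol numeral `bin 2 = [0, 1]`). [folklore] -/
def isT : List Bool → List Bool := eqPairFn ∘ fanoutFn symF fun _ => [false, true]

/-- Push `k` copies of the popped code onto the accumulator (field `≥ 2`). [folklore] -/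
def pushF : ℕ → List Bool → List Bool
  | 0 => sndPow 1
  | k + 1 => fanoutFn itemF (pushF k)

/-- The new accumulator: `3`, `7` or `1` copies pushed. [folklore] -/
def newAccF : List Bool → List Bool := iteFn isS (pushF 3) (iteFn isT (pushF 7) (pushF 1))

/-- **One round** on records `⟨x, ⟨rest, acc⟩⟩`: idle (reassemble) if `rest = []`, else pop the
first code of `rest` and push its copies onto `acc`. [folklore] -/
def roundF : List Bool → List Bool :=
  iteFn (isNilFn ∘ nthF 1) (fanoutFn (nthF 0) (fanoutFn (nthF 1) (sndPow 1)))
    (fanoutFn (nthF 0) (fanoutFn (sndF ∘ nthF 1) newAccF))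

/-- The initial record `⟨s, ⟨s, []⟩⟩`. [folklore] -/
def initF : List Bool → List Bool := fanoutFn id (fanoutFn id fun _ => [])

/-- **The inverse-code map**: `|s|` rounds from `⟨s, ⟨s, []⟩⟩`, then the accumulator.
[cite: BernsteinVazirani1997, §8] -/
def invCodeFn : List Bool → List Bool :=
  sndPow 1 ∘ (fun z => roundF^[(X : ℕ[X]).eval (boolUnpair z).1.length] z) ∘ initF

/-! ### Membership in `FP` -/

/-- `itemF ∈ FP`. [folklore] -/
theorem itemF_mem_FP : itemF ∈ FP :=
  comp_mem_FP takeFn_mem_FP (fanoutFn_mem_FP (nthF_mem_FP 0) (comp_mem_FP fstF_mem_FP (nthF_mem_FP 1)))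

/-- `symF ∈ FP`. [folklore] -/
theorem symF_mem_FP : symF ∈ FP :=
  comp_mem_FP fstF_mem_FP (comp_mem_FP dropFn_mem_FP (fanoutFn_mem_FP (const_mem_FP _) itemF_mem_FP))

/-- `isS ∈ FP`. [folklore] -/
theorem isS_mem_FP : isS ∈ FP := comp_mem_FP eqPairFn_mem_FP (fanoutFn_mem_FP symF_mem_FP (const_mem_FP _))

/-- `isT ∈ FP`. [folklore] -/
theorem isT_mem_FP : isT ∈ FP := comp_mem_FP eqPairFn_mem_FP (fanoutFn_mem_FP symF_mem_FP (const_mem_FP _))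

/-- `pushF k ∈ FP`. [folklore] -/
theorem pushF_mem_FP : ∀ k, pushF k ∈ FP
  | 0 => sndPow_mem_FP 1
  | k + 1 => fanoutFn_mem_FP itemF_mem_FP (pushF_mem_FP k)

/-- `newAccF ∈ FP`. [folklore] -/
theorem newAccF_mem_FP : newAccF ∈ FP :=
  iteFn_mem_FP isS_mem_FP (pushF_mem_FP 3) (iteFn_mem_FP isT_mem_FP (pushF_mem_FP 7) (pushF_mem_FP 1))

/-- `roundF ∈ FP`. [folklore] -/
theorem roundF_mem_FP : roundF ∈ FP :=
  iteFn_mem_FP (comp_mem_FP isNilFn_mem_FP (nthF_mem_FP 1))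
    (fanoutFn_mem_FP (nthF_mem_FP 0) (fanoutFn_mem_FP (nthF_mem_FP 1) (sndPow_mem_FP 1)))
    (fanoutFn_mem_FP (nthF_mem_FP 0) (fanoutFn_mem_FP (comp_mem_FP sndF_mem_FP (nthF_mem_FP 1)) newAccF_mem_FP))

/-- `initF ∈ FP`. [folklore] -/
theorem initF_mem_FP : initF ∈ FP :=
  fanoutFn_mem_FP (PolyTimeComputable.id _) (fanoutFn_mem_FP (PolyTimeComputable.id _) (const_mem_FP _))

/-! ### Growth of the round -/

/-- The tests are one-bit. [folklore] -/
theorem oneBit_isS : OneBit isS := fun z => by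
  rcases eqPairFn_eq_or (fanoutFn symF (fun _ => [true]) z) with h | h
  · exact ⟨true, h⟩
  · exact ⟨false, h⟩

/-- The tests are one-bit. [folklore] -/
theorem oneBit_isT : OneBit isT := fun z => by
  rcases eqPairFn_eq_or (fanoutFn symF (fun _ => [false, true]) z) with h | h
  · exact ⟨true, h⟩
  · exact ⟨false, h⟩

/-- The popped code is no longer than the input field. [folklore] -/
theorem length_itemF_le (z : List Bool) : (itemF z).length ≤ (fstF z).length := by
  simp only [itemF, Function.comp_apply, fanoutFn_apply, takeFn_boolPair, nthF_zero]
  exact List.length_take_le _ _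

/-- Length of a push. [folklore] -/
theorem length_pushF (k : ℕ) (z : List Bool) :
    (pushF k z).length = k * (2 * (itemF z).length + 2) + (sndPow 1 z).length := by
  induction k with
  | zero => simp [pushF]
  | succ k ih => rw [pushF, length_fanoutFn, ih]; ring

/-- The new accumulator grows by at most `7` truncated codes. [folklore] -/
theorem length_newAccF_le (z : List Bool) : (newAccF z).length ≤ 14 * (fstF z).length + 14 + (sndPow 1 z).length := by
  have hi := length_itemF_le z
  have h7 : ∀ k ≤ 7, (pushF k z).length ≤ 14 * (fstF z).length + 14 + (sndPow 1 z).length := fun k hk => by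
    rw [length_pushF]; nlinarith
  rw [newAccF, iteFn_of_oneBit oneBit_isS]
  split_ifs
  · exact h7 3 (by norm_num)
  · rw [iteFn_of_oneBit oneBit_isT]
    split_ifs
    · exact h7 7 le_rfl
    · exact h7 1 (by norm_num)

/-- The fields are short: `2|x| + 2|rest| + |acc| ≤ |z|` for `x, rest, acc` the three fields.
[folklore] -/
theorem length_fields_le (z : List Bool) :
    2 * (fstF z).length + 2 * (nthF 1 z).length + (sndPow 1 z).length ≤ z.length := by
  have h0 := length_fstF_sndF_le z
  have h1 := length_fstF_sndF_le (sndF z)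
  simp only [nthF, sndPow, Function.comp_apply]
  omega

/-- The round is an honest case distinction. [folklore] -/
theorem roundF_apply (z : List Bool) :
    roundF z = if (isNilFn ∘ nthF 1) z = [true] then fanoutFn (nthF 0) (fanoutFn (nthF 1) (sndPow 1)) z
      else fanoutFn (nthF 0) (fanoutFn (sndF ∘ nthF 1) newAccF) z :=
  iteFn_of_oneBit (oneBit_isNilFn.comp _) _ _ z

/-- **The round keeps the input field.** [folklore] -/
theorem fstF_roundF (z : List Bool) : fstF (roundF z) = fstF z := by
  rw [roundF_apply]
  split_ifs <;> simp

/-- **Linear growth of the round** in the input field. [folklore] -/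
theorem length_roundF_le (z : List Bool) : (roundF z).length ≤ z.length + 18 * ((fstF z).length + 1) := by
  have hf := length_fields_le z
  rw [roundF_apply]
  split_ifs
  · rw [length_fanoutFn, length_fanoutFn]
    simp only [nthF_zero]
    omega
  · rw [length_fanoutFn, length_fanoutFn]
    simp only [nthF_zero, Function.comp_apply]
    have hn := length_newAccF_le z
    have hs : (sndF (nthF 1 z)).length ≤ (nthF 1 z).length := by
      have := length_fstF_sndF_le (nthF 1 z); omega
    omega

/-- **`invCodeFn ∈ FP`.** [cite: AroraBarak2009, §1.3, Remark 6.7] -/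
theorem invCodeFn_mem_FP : invCodeFn ∈ FP :=
  comp_mem_FP (sndPow_mem_FP 1) (comp_mem_FP
    (iterate_mem_FP_of_growth roundF_mem_FP 18 fstF_roundF length_roundF_le X) initF_mem_FP)

/-! ### Semantics -/

/-- `symbolOfCode` through the bricks. [folklore] -/
theorem symbolOfCode_eq (a : List Bool) : symbolOfCode a = fstF (a.drop 1) := by
  rw [symbolOfCode, List.drop_one]; rfl

/-- The round on a non-empty remaining list whose first code fits the input field.
[folklore] -/
theorem roundF_cons (x a acc : List Bool) (l : List (List Bool)) (ha : a.length ≤ x.length) :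
    roundF (boolPair x (boolPair (encList (a :: l)) acc)) =
      boolPair x (boolPair (encList l) ((List.replicate (invRepsOfCode a) a).foldr boolPair acc)) := by
  set z := boolPair x (boolPair (encList (a :: l)) acc) with hz
  have hrest : nthF 1 z = boolPair a (encList l) := by simp [hz, encList_cons]
  have hx : nthF 0 z = x := by simp [hz]
  have hacc : sndPow 1 z = acc := by simp [hz]
  have hitem : itemF z = a := by
    simp only [itemF, Function.comp_apply, fanoutFn_apply, hx, hrest, fstF_boolPair, takeFn_boolPair]
    exact List.take_of_length_le ha
  have hsym : symF z = symbolOfCode a := by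
    simp only [symF, Function.comp_apply, fanoutFn_apply, hitem, dropFn_boolPair, List.length_singleton, symbolOfCode_eq]
  have hpush : ∀ k, pushF k z = (List.replicate k a).foldr boolPair acc := fun k => by
    induction k with
    | zero => simp [pushF, hacc]
    | succ k ih => rw [pushF, fanoutFn_apply, hitem, ih, List.replicate_succ, List.foldr_cons]
  have hnil : (isNilFn ∘ nthF 1) z = [false] := by
    simp only [Function.comp_apply, hrest, isNilFn]
    cases a <;> simp [boolPair]
  have hrest' : (sndF ∘ nthF 1) z = encList l := by rw [Function.comp_apply, hrest, sndF_boolPair]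
  have hS : isS z = [decide (symbolOfCode a = [true])] := by
    simp only [isS, Function.comp_apply, fanoutFn_apply, hsym, eqPairFn_boolPair]
  have hT : isT z = [decide (symbolOfCode a = [false, true])] := by
    simp only [isT, Function.comp_apply, fanoutFn_apply, hsym, eqPairFn_boolPair]
  have hnew : newAccF z = (List.replicate (invRepsOfCode a) a).foldr boolPair acc := by
    rw [newAccF, iteFn_of_oneBit oneBit_isS]
    unfold invRepsOfCode
    by_cases h1 : symbolOfCode a = [true]
    · rw [if_pos (by rw [hS, h1]; rfl), if_pos h1, hpush]
    · rw [if_neg (by rw [hS]; simp [h1]), if_neg h1, iteFn_of_oneBit oneBit_isT]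
      by_cases h2 : symbolOfCode a = [false, true]
      · rw [if_pos (by rw [hT, h2]; rfl), if_pos h2, hpush]
      · rw [if_neg (by rw [hT]; simp [h2]), if_neg h2, hpush]
  rw [roundF_apply, if_neg (by rw [hnil]; decide), fanoutFn_apply, fanoutFn_apply, hx, hrest', hnew]

/-- The round idles on an empty remaining list. [folklore] -/
theorem roundF_nil (x acc : List Bool) : roundF (boolPair x (boolPair [] acc)) = boolPair x (boolPair [] acc) := by
  have hnil : (isNilFn ∘ nthF 1) (boolPair x (boolPair [] acc)) = [true] := by simp [isNilFn]
  rw [roundF_apply, if_pos hnil]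
  simp

/-- Pushing copies in front of a pair list. [folklore] -/
theorem foldr_boolPair_encList (k : ℕ) (a : List Bool) (L : List (List Bool)) :
    (List.replicate k a).foldr boolPair (encList L) = encList (List.replicate k a ++ L) := by
  induction k with
  | zero => rfl
  | succ k ih => rw [List.replicate_succ, List.foldr_cons, ih, List.cons_append, encList_cons]

/-- **The rounds on a pair list**: with at least as many rounds as codes, all fitting the input
field, the remaining list is emptied and the accumulator holds `invCodeItems items ++ L`.
[folklore] -/
theorem iterate_roundF (x : List Bool) : ∀ (items L : List (List Bool)) (n : ℕ), items.length ≤ n →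
    (∀ a ∈ items, a.length ≤ x.length) →
    roundF^[n] (boolPair x (boolPair (encList items) (encList L))) =
      boolPair x (boolPair [] (encList (invCodeItems items ++ L)))
  | [], L, n, _, _ => by
    rw [encList_nil, invCodeItems_nil, List.nil_append]
    exact Function.iterate_fixed (roundF_nil x _) n
  | a :: items, L, 0, h, _ => by simp at h
  | a :: items, L, n + 1, h, hfit => by
    rw [Function.iterate_succ_apply, roundF_cons x a _ items (hfit a (by simp)), foldr_boolPair_encList,
      iterate_roundF x items _ n (by simpa using h) (fun b hb => hfit b (by simp [hb])), invCodeItems_cons, List.append_assoc]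

/-- Codes of a pair list are shorter than the list. [folklore] -/
theorem length_le_of_mem_encList {items : List (List Bool)} {a : List Bool} (h : a ∈ items) :
    a.length ≤ (encList items).length := by
  induction items with
  | nil => simp at h
  | cons b items ih =>
    rw [encList_cons, length_boolPair]
    rcases List.mem_cons.1 h with rfl | h
    · omega
    · have := ih h; omega

/-- **`invCodeFn (encList items) = encList (invCodeItems items)`.** [cite: BernsteinVazirani1997, §8] -/
theorem invCodeFn_encList (items : List (List Bool)) : invCodeFn (encList items) = encList (invCodeItems items) := by
  have hinit : initF (encList items) = boolPair (encList items) (boolPair (encList items) (encList [])) := by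
    simp [initF, fanoutFn_apply]
  simp only [invCodeFn, Function.comp_apply, hinit, boolUnpair_boolPair, eval_X]
  rw [iterate_roundF (encList items) items [] _ (Com.length_le_length_encList items) (fun a ha => length_le_of_mem_encList ha),
    List.append_nil]
  simp

/-- **The description of the inverse circuit is `invCodeFn` of the description**, for
oracle-free Clifford+T circuits. [cite: BernsteinVazirani1997, §8] -/
theorem invCodeFn_encode {N : ℕ} {C : Cryptography.QCircuit Cryptography.cliffordT N} (hC : C.IsOracleFree) :
    invCodeFn C.encode = C.inv.encode := by
  rw [encode_inv hC, Cryptography.QCircuit.encode_eq_encList, invCodeFn_encList]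

end InvCode

end Literature.Computability.QuantumComplexity
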